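import Summits.QuantumFields.YangMills.Theorems.BalabanUVNodesN21MixtureSlotMeasure

/-!
# YM-DAG node N21 (= NE7c) — ROAD I AT THE MIXTURE CARRIERS FROM SHARP PUSHES: the `LevelLedger.slot` field ((M1)-by-level, road I's only
# analytic binder) is a Fubini THEOREM when the carriers' pieces and weights are normalised threshold-window averages of SHARP ones obeying the
# [dict] push AT EVERY THRESHOLD of the window (lens Card 6 ∕ ROW A′ §1–§2, sharp-push form; companion of file 7's mixture-measure form)

Track A of `YM-PLAN.md` (cell `pub-ymgap`, HUMAN RULING D-0062), node **N21**; LANDED BY the R134 fan-out seat `pub-ymgap-dag-n21-d` (s2), generation 3, module 12a =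
ROW A′ of the lens memo `ym-lens-BalabanUVNodes-nearmiss/LENS-nearmiss.md` v3.0 §2 Card 6 (pub-ymgap INBOX l.14024; dag-lead g6 REBALANCE №58 OFFER l.≈14115, accepted
l.14146).  §1–§2 are the DRAFT of the sibling seat `pub-ymgap-dag-n21-e` (g2, `BalabanUVNodesN21LevelLedgerMixture.DRAFT-NOT-FILED.lean` sha16 5730c5ef5f798445, handed
over at INBOX l.14168 — «cannibalise freely») taken VERBATIM; §3 is typed here under the name dag-n21-e announced.  Companion of dag-n21-e's file 7
`…N21MixtureSlotMeasure` (p469525), which states the [dict] push AT THE MIXTURE MEASURE `ν ⊗ Leb|[(1−κ)θ, θ]`; HERE the push is the SHARP one, read UNIFORMLY in the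
slot's own threshold over the window — the form NODE O's sharp term object meets first —, and the carriers' pieces ∕ weights are PINNED as the normalised window
averages (the form road I's explicit-carrier modules at the Stage-12 home consume: module 12b `…N21AtRRec12Mixture`).  Kernel bookkeeping + Fubini: 0 `def`,
0 `sorry`, standard axioms.  COUNT-NEUTRAL; `--supports` the K3′ item `SpineGivenEndpointR12` (rev 15, stmt-QuantumFields-19908) as a helper.

CREDIT.  §1 (`slot_field_of_thresholdMixture`, `mixture_slot_field`) was TYPED AND FARM-PROVED by the planner LENS seat `ym-lens-BalabanUVNodes-nearmiss`
(gen 3) in `Sketch-nearmiss-g3.lean` (sha16 649704ec92082a3d, ns `YMLens.NearMissN21G3`); that seat has no ledger writes by instruction, so a prover seat lands the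
two statements VERBATIM with this attribution (the proof cites file 5a's landed `thresholdMixture_shell_le`, itself the lens's).  `mixture_slot_field_two` and §2
(`levelLedger_of_thresholdMixture`, `n21_knit_thresholdMixture`) are dag-n21-e's typing (g2), landed unchanged.  §3 (`s_N21_of_sharpPushMixtureReading`) is dag-n21-d's.

HONEST FRAMING.  NE7c is NOT PRINTED and NOT PROVED; print fixes its thresholds once.  For one slot at level `j` (tested variable `w`, threshold `θ_j`,
admissible width `κ_j`, relative two-run width `ρ_j`): IF at EVERY threshold `s ∈ [(1 − κ_j)θ_j, θ_j]` the sharp pieces over the terms are `≤ M·ν{s(1−ρ_j) ≤ w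
< s}` and `M·ν(univ) ≤ Σ_τ A^sharp_τ(s)` — the two readings `T4ShellMeasure.slot_field_of_antiConcentration` takes, now uniform in the threshold; located input
(O-mix-2)∕[dict] of the lens, NODE O at the Stage-12 record — THEN the window-averaged pieces and weights satisfy road I's slot field with `D_j = 2κ_j⁻¹`, for
EVERY `ρ_j ≥ 0`, with NO anti-concentration hypothesis on the field law `ν` (§1: Fubini in the threshold).  So road I's `LevelLedger` (§2), the N21 knit
`n21_knit_levels` (§2) and the K5 stub (§3) follow from: the sharp pushes (NODE O), admissible widths `κ_min ≤ κ_j < 1` (`T4LipschitzCutoff` §5∕§7; one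
multiplier per cube ∕ occurrence, (O-mix-3′)), live windows (N20) and the width rate `ρ_j ≤ c₁ϑ^j` (N16).  NOT print's construction verbatim (a convex
combination of print's sharp procedure over admissible thresholds); NOT (M1) for the deterministic sharp procedure; the lever (randomised thresholds ∕ dither) is
KNOWN elsewhere and new only on this problem (lens §5); N16 ∕ N20 untouched; **N21 NOT discharged**; one finite four-torus programme at fixed `ε`; NOT continuum ∕
ℝ⁴ ∕ OS ∕ mass gap ∕ Clay.

CITATION HEADER (lean-in-tree rule 2026-08-18).  Everything BY NAME from the tree: file 5a `thresholdMixture_shell_le` (p466893); file 7 `two_mul_inv_le`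
(p469525); n21-a's `n21_knit_levels` (p408928); `T4ShellMeasureLevels.LevelLedger` ∕ `LiveWindow`; Mathlib `integral_finsetSum`, `setIntegral_mono_on`,
`measurable_measure_prodMk_right`, `Measure.prod_apply_symm`, `integral_toReal`.  Context only (SHAPE): [Balaban1988Convergent] (2.17)∕(2.18) p. 257.

WHAT IS PROVED ([folklore]).  §1 `slot_field_of_thresholdMixture` · `mixture_slot_field` (lens g3, verbatim) · `mixture_slot_field_two` (dag-n21-e: the same with the
width-free constant `2κ⁻¹`, every `ρ ≥ 0`).  §2 `levelLedger_of_thresholdMixture` (ONE run) · `n21_knit_thresholdMixture` (two runs ⇒ `ShellWeightBound` at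
`D̄ = 2κ_min⁻¹`).  §3 `s_N21_of_sharpPushMixtureReading` (the K5 stub `S_N21 SRec` for every SHARP-PUSH MIXTURE reading predicate, ∃-closed exactly as dag-n21-e's
`s_N21_of_mixtureSlotReading` with the pushes read at the sharp thresholds and the carriers pinned as window averages).  No decl below carries a cite tag.
-/

set_option autoImplicit false

noncomputable section

open scoped BigOperators ENNReal
open MeasureTheory Set

namespace Summit.QuantumFields.YangMills.Theorems.N21LevelLedgerMixture

open Literature.MathematicalPhysics.QuantumFieldTheory.Balaban1983to89
open T4IndicatorShell (ShellWeightBound)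
open T4ShellMeasureLevels (LevelLedger LiveWindow)
open YMDAG.UVSplit (SpineCarriers SpineRecordPred S_N21)
open N21ThresholdMixture (thresholdMixture_shell_le)
open N21MixtureSlotMeasure (two_mul_inv_le)

/-! ## §1 The slot field at the mixture carriers from sharp pushes uniform in the threshold (lens g3, verbatim) -/

section ShellMass

variable {X : Type*} [MeasurableSpace X]

/-- **ROAD I AT THE MIXTURE CARRIERS: the slot ledger field WITHOUT (M1).**  For one slot (tested variable `u`, threshold `θ`, transition width `κ`,
relative two-run closeness `ρ`) and one `(K, t)`: if at EVERY threshold `s` of the window `[(1 − κ)θ, θ]` the sharp run's pieces over the terms are at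
most `M ·` (the `μ`-mass of the sharp shell `{s(1 − ρ) ≤ u < s}`) and `M · μ(univ) ≤ Σ_τ A^sharp_τ(s)`, then the WINDOW-INTEGRATED pieces and weights
satisfy `Σ_τ ∫ piece ≤ (Dρ)·Σ_τ ∫ A` with `D = ((1 − ρ)κ)⁻¹` — by `thresholdMixture_shell_le` (Fubini), with NO anti-concentration hypothesis on `μ`.
(Typed and proved by the lens seat `ym-lens-BalabanUVNodes-nearmiss` g3; landed verbatim.) [folklore] -/
theorem slot_field_of_thresholdMixture {ι : Type*} {μ : Measure X} [IsFiniteMeasure μ] {u : X → ℝ}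
    (hu : Measurable u) {θ ρ κ M : ℝ} (hθ : 0 < θ) (hρ0 : 0 ≤ ρ) (hρ1 : ρ < 1) (hκ0 : 0 < κ)
    (hM : 0 ≤ M) (T : Finset ι) {pc Ash : ℝ → ι → ℝ}
    (hpc_int : ∀ τ ∈ T, IntegrableOn (fun s => pc s τ) (Icc ((1 - κ) * θ) θ))
    (hA_int : ∀ τ ∈ T, IntegrableOn (fun s => Ash s τ) (Icc ((1 - κ) * θ) θ))
    (hpiece : ∀ s ∈ Icc ((1 - κ) * θ) θ,
      ∑ τ ∈ T, pc s τ ≤ M * (μ {x | s * (1 - ρ) ≤ u x ∧ u x < s}).toReal)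
    (hA : ∀ s ∈ Icc ((1 - κ) * θ) θ, M * (μ univ).toReal ≤ ∑ τ ∈ T, Ash s τ) :
    ∑ τ ∈ T, ∫ s in Icc ((1 - κ) * θ) θ, pc s τ
      ≤ (((1 - ρ)⁻¹ * κ⁻¹) * ρ) * ∑ τ ∈ T, ∫ s in Icc ((1 - κ) * θ) θ, Ash s τ := by
  have h1ρ : 0 < 1 - ρ := by linarith
  have hκθ : 0 < κ * θ := mul_pos hκ0 hθ
  have hθa : θ - (1 - κ) * θ = κ * θ := by ring
  set W : Set ℝ := Icc ((1 - κ) * θ) θ with hW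
  -- the moving shell as a measurable subset of the product, and its sections
  set S : Set (X × ℝ) := {p : X × ℝ | p.2 * (1 - ρ) ≤ u p.1 ∧ u p.1 < p.2} with hS
  have hSm : MeasurableSet S :=
    (measurableSet_le (measurable_snd.mul_const _) (hu.comp measurable_fst)).inter
      (measurableSet_lt (hu.comp measurable_fst) measurable_snd)
  have hsec : ∀ s : ℝ, (fun x => (x, s)) ⁻¹' S = {x | s * (1 - ρ) ≤ u x ∧ u x < s} := fun s => rfl
  have hmeasS : Measurable fun s : ℝ => μ ((fun x => (x, s)) ⁻¹' S) := measurable_measure_prodMk_right hSm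
  -- (1) LHS ≤ M · ∫_W μ(shell s).toReal ds
  have hLHS : ∑ τ ∈ T, ∫ s in W, pc s τ ≤ M * ∫ s in W, (μ ((fun x => (x, s)) ⁻¹' S)).toReal := by
    rw [← integral_finsetSum T fun τ hτ => hpc_int τ hτ, ← integral_const_mul]
    refine setIntegral_mono_on (integrable_finsetSum T fun τ hτ => hpc_int τ hτ) ?_ measurableSet_Icc ?_
    · refine Integrable.const_mul ?_ M
      refine (integrable_const (μ univ).toReal).mono' ?_ (ae_of_all _ fun s => ?_)
      · exact (ENNReal.measurable_toReal.comp hmeasS).aestronglyMeasurable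
      · rw [Real.norm_eq_abs, abs_of_nonneg ENNReal.toReal_nonneg]
        exact ENNReal.toReal_mono (measure_ne_top _ _) (measure_mono (subset_univ _))
    · intro s hs
      rw [hsec]
      exact hpiece s hs
  -- (2) ∫_W μ(shell s) ds = (μ ⊗ Leb|W)(S) ≤ θρ/(1−ρ) · μ(univ)   [Fubini in the threshold direction]
  have hFub : ∫ s in W, (μ ((fun x => (x, s)) ⁻¹' S)).toReal ≤ θ * ρ / (1 - ρ) * (μ univ).toReal := by
    rw [integral_toReal hmeasS.aemeasurable (ae_of_all _ fun s => measure_lt_top _ _),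
      ← Measure.prod_apply_symm hSm]
    have h := thresholdMixture_shell_le μ hu (a := (1 - κ) * θ) (θ := θ) hρ0 hρ1
    have h' := ENNReal.toReal_mono (ENNReal.mul_ne_top ENNReal.ofReal_ne_top (measure_ne_top _ _)) h
    rwa [ENNReal.toReal_mul, ENNReal.toReal_ofReal (by positivity)] at h'
  -- (3) RHS ≥ (κθ) · M · μ(univ)
  have hRHS : κ * θ * (M * (μ univ).toReal) ≤ ∑ τ ∈ T, ∫ s in W, Ash s τ := by
    rw [← integral_finsetSum T fun τ hτ => hA_int τ hτ]
    have hc : ∫ _ in W, M * (μ univ).toReal = κ * θ * (M * (μ univ).toReal) := by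
      rw [setIntegral_const, measureReal_def, hW, Real.volume_Icc, hθa, ENNReal.toReal_ofReal hκθ.le,
        smul_eq_mul]
    rw [← hc]
    exact setIntegral_mono_on (integrable_const _) (integrable_finsetSum T fun τ hτ => hA_int τ hτ)
      measurableSet_Icc fun s hs => hA s hs
  -- assemble
  have hD : 0 ≤ (1 - ρ)⁻¹ * κ⁻¹ * ρ := by positivity
  calc ∑ τ ∈ T, ∫ s in W, pc s τ ≤ M * ∫ s in W, (μ ((fun x => (x, s)) ⁻¹' S)).toReal := hLHS
    _ ≤ M * (θ * ρ / (1 - ρ) * (μ univ).toReal) := mul_le_mul_of_nonneg_left hFub hM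
    _ = ((1 - ρ)⁻¹ * κ⁻¹ * ρ) * (κ * θ * (M * (μ univ).toReal)) := by
          field_simp
    _ ≤ ((1 - ρ)⁻¹ * κ⁻¹ * ρ) * ∑ τ ∈ T, ∫ s in W, Ash s τ := mul_le_mul_of_nonneg_left hRHS hD

/-- **THE `LevelLedger.slot` ∕ `SlotLedger.slot` FIELD AT THE MIXTURE CARRIERS** (the literal plug for road I): if the carriers' pieces and weights ARE
the normalised window averages of the sharp ones, the field holds with the level constant `D = ((1 − ρ)κ)⁻¹` — NO (M1).  (Lens seat g3; landed verbatim.)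
[folklore] -/
theorem mixture_slot_field {ι : Type*} {μ : Measure X} [IsFiniteMeasure μ] {u : X → ℝ}
    (hu : Measurable u) {θ ρ κ M : ℝ} (hθ : 0 < θ) (hρ0 : 0 ≤ ρ) (hρ1 : ρ < 1) (hκ0 : 0 < κ)
    (hM : 0 ≤ M) (T : Finset ι) {pc Ash : ℝ → ι → ℝ} {piece A : ι → ℝ}
    (hpc_int : ∀ τ ∈ T, IntegrableOn (fun s => pc s τ) (Icc ((1 - κ) * θ) θ))
    (hA_int : ∀ τ ∈ T, IntegrableOn (fun s => Ash s τ) (Icc ((1 - κ) * θ) θ))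
    (hpiece : ∀ s ∈ Icc ((1 - κ) * θ) θ,
      ∑ τ ∈ T, pc s τ ≤ M * (μ {x | s * (1 - ρ) ≤ u x ∧ u x < s}).toReal)
    (hA : ∀ s ∈ Icc ((1 - κ) * θ) θ, M * (μ univ).toReal ≤ ∑ τ ∈ T, Ash s τ)
    (hpieceMix : ∀ τ ∈ T, piece τ = (κ * θ)⁻¹ * ∫ s in Icc ((1 - κ) * θ) θ, pc s τ)
    (hAMix : ∀ τ ∈ T, A τ = (κ * θ)⁻¹ * ∫ s in Icc ((1 - κ) * θ) θ, Ash s τ) :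
    ∑ τ ∈ T, piece τ ≤ (((1 - ρ)⁻¹ * κ⁻¹) * ρ) * ∑ τ ∈ T, A τ := by
  have hκθ : 0 < κ * θ := mul_pos hκ0 hθ
  rw [Finset.sum_congr rfl hpieceMix, Finset.sum_congr rfl hAMix, ← Finset.mul_sum, ← Finset.mul_sum,
    mul_left_comm]
  exact mul_le_mul_of_nonneg_left
    (slot_field_of_thresholdMixture hu hθ hρ0 hρ1 hκ0 hM T hpc_int hA_int hpiece hA) (inv_nonneg.2 hκθ.le)

/-- **THE SAME WITH THE WIDTH-FREE CONSTANT `2κ⁻¹`, FOR EVERY `ρ ≥ 0`** (this seat): for `ρ ≤ 1∕2` the lens's field with `(1 − ρ)⁻¹ ≤ 2`; for `ρ > 1∕2`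
the pushes give `Σ_τ piece ≤ Σ_τ A` outright (pieces ≤ `M·`shell mass ≤ `M·`total mass ≤ weights, threshold by threshold) and `2κ⁻¹ρ ≥ 1`. [folklore] -/
theorem mixture_slot_field_two {ι : Type*} {μ : Measure X} [IsFiniteMeasure μ] {u : X → ℝ}
    (hu : Measurable u) {θ ρ κ M : ℝ} (hθ : 0 < θ) (hρ0 : 0 ≤ ρ) (hκ0 : 0 < κ) (hκ1 : κ < 1)
    (hM : 0 ≤ M) (T : Finset ι) {pc Ash : ℝ → ι → ℝ} {piece A : ι → ℝ}
    (hpc_int : ∀ τ ∈ T, IntegrableOn (fun s => pc s τ) (Icc ((1 - κ) * θ) θ))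
    (hA_int : ∀ τ ∈ T, IntegrableOn (fun s => Ash s τ) (Icc ((1 - κ) * θ) θ))
    (hpiece : ∀ s ∈ Icc ((1 - κ) * θ) θ,
      ∑ τ ∈ T, pc s τ ≤ M * (μ {x | s * (1 - ρ) ≤ u x ∧ u x < s}).toReal)
    (hA : ∀ s ∈ Icc ((1 - κ) * θ) θ, M * (μ univ).toReal ≤ ∑ τ ∈ T, Ash s τ)
    (hpieceMix : ∀ τ ∈ T, piece τ = (κ * θ)⁻¹ * ∫ s in Icc ((1 - κ) * θ) θ, pc s τ)
    (hAMix : ∀ τ ∈ T, A τ = (κ * θ)⁻¹ * ∫ s in Icc ((1 - κ) * θ) θ, Ash s τ) :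
    ∑ τ ∈ T, piece τ ≤ ((2 * κ⁻¹) * ρ) * ∑ τ ∈ T, A τ := by
  have hκθ : 0 < κ * θ := mul_pos hκ0 hθ
  -- the weights are nonnegative in total: `0 ≤ M·μ(univ) ≤ Σ Ash(s)` window-wise
  have hAsum_nonneg : 0 ≤ ∑ τ ∈ T, A τ := by
    rw [Finset.sum_congr rfl hAMix, ← Finset.mul_sum, ← integral_finsetSum T fun τ hτ => hA_int τ hτ]
    refine mul_nonneg (inv_nonneg.2 hκθ.le) (setIntegral_nonneg measurableSet_Icc fun s hs => ?_)
    exact (mul_nonneg hM ENNReal.toReal_nonneg).trans (hA s hs)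
  by_cases hρ : ρ ≤ 1 / 2
  · have h := mixture_slot_field hu hθ hρ0 (by linarith) hκ0 hM T hpc_int hA_int hpiece hA hpieceMix hAMix
    refine h.trans (mul_le_mul_of_nonneg_right (mul_le_mul_of_nonneg_right ?_ hρ0) hAsum_nonneg)
    have h1ρ : 0 < 1 - ρ := by linarith
    have hinv : (1 - ρ)⁻¹ ≤ 2 := by rw [inv_le_comm₀ h1ρ (by norm_num)]; linarith
    exact mul_le_mul_of_nonneg_right hinv (inv_nonneg.2 hκ0.le)
  · rw [not_le] at hρ
    -- pieces ≤ weights threshold by threshold, hence after averaging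
    have hpw : ∀ s ∈ Icc ((1 - κ) * θ) θ, ∑ τ ∈ T, pc s τ ≤ ∑ τ ∈ T, Ash s τ := fun s hs =>
      (hpiece s hs).trans ((mul_le_mul_of_nonneg_left
        (ENNReal.toReal_mono (measure_ne_top _ _) (measure_mono (subset_univ _))) hM).trans (hA s hs))
    have hle : ∑ τ ∈ T, piece τ ≤ ∑ τ ∈ T, A τ := by
      rw [Finset.sum_congr rfl hpieceMix, Finset.sum_congr rfl hAMix, ← Finset.mul_sum, ← Finset.mul_sum,
        ← integral_finsetSum T fun τ hτ => hpc_int τ hτ, ← integral_finsetSum T fun τ hτ => hA_int τ hτ]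
      refine mul_le_mul_of_nonneg_left ?_ (inv_nonneg.2 hκθ.le)
      exact setIntegral_mono_on (integrable_finsetSum T fun τ hτ => hpc_int τ hτ)
        (integrable_finsetSum T fun τ hτ => hA_int τ hτ) measurableSet_Icc hpw
    have hκinv : 1 ≤ κ⁻¹ := (one_le_inv₀ hκ0).2 hκ1.le
    have h1 : (1 : ℝ) ≤ 2 * κ⁻¹ * ρ := by nlinarith
    calc ∑ τ ∈ T, piece τ ≤ ∑ τ ∈ T, A τ := hle
      _ = 1 * ∑ τ ∈ T, A τ := (one_mul _).symm
      _ ≤ (2 * κ⁻¹ * ρ) * ∑ τ ∈ T, A τ := mul_le_mul_of_nonneg_right h1 hAsum_nonneg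

end ShellMass

/-! ## §2 One run and two runs: road I's level ledgers from sharp pushes uniform in the threshold, carriers pinned as window averages -/

section Explicit

variable {ι σ σ' : Type*} {XA : ℕ → σ → Type*} {XB : ℕ → σ' → Type*} [∀ K s, MeasurableSpace (XA K s)] [∀ K s, MeasurableSpace (XB K s)]
  {l₀ : ℝ} {T : ℕ → Finset ι} {A B shA shB : ℕ → ℝ → ι → ℝ} {SA : ℕ → Finset σ} {SB : ℕ → Finset σ'}
  {pieceA : ℕ → ℝ → σ → ι → ℝ} {pieceB : ℕ → ℝ → σ' → ι → ℝ} {lvlA : ℕ → σ → ℕ} {lvlB : ℕ → σ' → ℕ}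
  {νA : ∀ K : ℕ, ℝ → ∀ s : σ, Measure (XA K s)} {νB : ∀ K : ℕ, ℝ → ∀ s : σ', Measure (XB K s)}
  [∀ K t s, IsFiniteMeasure (νA K t s)] [∀ K t s, IsFiniteMeasure (νB K t s)]
  {wA : ∀ K : ℕ, ℝ → ∀ s : σ, XA K s → ℝ} {wB : ∀ K : ℕ, ℝ → ∀ s : σ', XB K s → ℝ}
  {θA κA ρA θB κB ρB : ℕ → ℝ} {MA : ℕ → ℝ → σ → ℝ} {MB : ℕ → ℝ → σ' → ℝ}
  {pcA AsA : ∀ K : ℕ, ℝ → ∀ s : σ, ℝ → ι → ℝ} {pcB AsB : ∀ K : ℕ, ℝ → ∀ s : σ', ℝ → ι → ℝ}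

/-- **ONE RUN: road I's `LevelLedger` with `D_j = 2κ_j⁻¹` FROM SHARP PUSHES UNIFORM IN THE THRESHOLD.**  DATA: terms `T K` with weights `A` and shell parts
`sh`; slots `S K` at levels `lvl K s` with pieces `piece K t s`; per slot a finite field law `ν K t s`, a measurable tested variable `w K t s`, a [dict] constant
`M K t s ≥ 0`, and the SHARP piece ∕ weight families `pc K t s s' τ`, `As K t s s' τ` as functions of the slot's OWN threshold `s'`, integrable on the window
`[(1 − κ_j)θ_j, θ_j]`; by level: `θ_j > 0`, `0 < κ_j < 1`, `ρ_j ≥ 0`.  BINDERS: (R); the sharp pushes at EVERY threshold of the window (`hpush`, `htotal`); the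
carriers' pieces AND weights PINNED as the normalised window averages (`hpieceMix`, `hAMix` — the weight of a term is such an average in EACH of its slots'
thresholds, as it is for a product mixture).  CONCLUSION: `LevelLedger l₀ T A sh S piece lvl (fun j => 2(κ j)⁻¹) ρ` — NO (M1) binder. [folklore] -/
theorem levelLedger_of_thresholdMixture
    (sh_nonneg : ∀ K t, |t| ≤ l₀ → ∀ τ ∈ T K, 0 ≤ shA K t τ)
    (sh_le : ∀ K t, |t| ≤ l₀ → ∀ τ ∈ T K, shA K t τ ≤ A K t τ)
    (cover : ∀ K t, |t| ≤ l₀ → ∀ τ ∈ T K, shA K t τ ≤ ∑ s ∈ SA K, pieceA K t s τ)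
    (hw : ∀ K t s, Measurable (wA K t s)) (hθ : ∀ j, 0 < θA j) (hκ : ∀ j, 0 < κA j ∧ κA j < 1) (hρ : ∀ j, 0 ≤ ρA j)
    (hM : ∀ K t, |t| ≤ l₀ → ∀ s ∈ SA K, 0 ≤ MA K t s)
    (hpc_int : ∀ K t, |t| ≤ l₀ → ∀ s ∈ SA K, ∀ τ ∈ T K,
      IntegrableOn (fun s' => pcA K t s s' τ) (Icc ((1 - κA (lvlA K s)) * θA (lvlA K s)) (θA (lvlA K s))))
    (hAs_int : ∀ K t, |t| ≤ l₀ → ∀ s ∈ SA K, ∀ τ ∈ T K,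
      IntegrableOn (fun s' => AsA K t s s' τ) (Icc ((1 - κA (lvlA K s)) * θA (lvlA K s)) (θA (lvlA K s))))
    (hpush : ∀ K t, |t| ≤ l₀ → ∀ s ∈ SA K, ∀ s' ∈ Icc ((1 - κA (lvlA K s)) * θA (lvlA K s)) (θA (lvlA K s)),
      ∑ τ ∈ T K, pcA K t s s' τ ≤ MA K t s * (νA K t s {x | s' * (1 - ρA (lvlA K s)) ≤ wA K t s x ∧ wA K t s x < s'}).toReal)
    (htotal : ∀ K t, |t| ≤ l₀ → ∀ s ∈ SA K, ∀ s' ∈ Icc ((1 - κA (lvlA K s)) * θA (lvlA K s)) (θA (lvlA K s)),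
      MA K t s * (νA K t s univ).toReal ≤ ∑ τ ∈ T K, AsA K t s s' τ)
    (hpieceMix : ∀ K t, |t| ≤ l₀ → ∀ s ∈ SA K, ∀ τ ∈ T K, pieceA K t s τ =
      (κA (lvlA K s) * θA (lvlA K s))⁻¹ * ∫ s' in Icc ((1 - κA (lvlA K s)) * θA (lvlA K s)) (θA (lvlA K s)), pcA K t s s' τ)
    (hAMix : ∀ K t, |t| ≤ l₀ → ∀ s ∈ SA K, ∀ τ ∈ T K, A K t τ =
      (κA (lvlA K s) * θA (lvlA K s))⁻¹ * ∫ s' in Icc ((1 - κA (lvlA K s)) * θA (lvlA K s)) (θA (lvlA K s)), AsA K t s s' τ) :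
    LevelLedger l₀ T A shA SA pieceA lvlA (fun j => 2 * (κA j)⁻¹) ρA where
  sh_nonneg := sh_nonneg
  sh_le := sh_le
  cover := cover
  slot K t ht s hs :=
    mixture_slot_field_two (hw K t s) (hθ _) (hρ _) (hκ _).1 (hκ _).2 (hM K t ht s hs) (T K) (hpc_int K t ht s hs)
      (hAs_int K t ht s hs) (hpush K t ht s hs) (htotal K t ht s hs) (hpieceMix K t ht s hs) (hAMix K t ht s hs)
  D_nonneg j := by have := (hκ j).1; positivity
  ρ_nonneg := hρ

/-- **TWO RUNS: N21'S ROAD-I KNIT FROM SHARP PUSHES.**  Two such runs + live windows `(N₁, ν̄)` (N20) + `κ_min ≤ κ_j` (`0 < κ_min`) + the width rate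
`0 < ϑ < 1`, `ρ_j ≤ c₁ϑ^j` (N16) ⟹ `ShellWeightBound l₀ T A B shA shB Wsh` for every summable `Wsh ≥ 2((N₁+1)ν̄(2κ_min⁻¹)c₁ϑ^{−N₁})ϑ^K` (`n21_knit_levels`
at `D̄ = 2κ_min⁻¹`). [folklore] -/
theorem n21_knit_thresholdMixture
    (sh_nonnegA : ∀ K t, |t| ≤ l₀ → ∀ τ ∈ T K, 0 ≤ shA K t τ)
    (sh_leA : ∀ K t, |t| ≤ l₀ → ∀ τ ∈ T K, shA K t τ ≤ A K t τ)
    (coverA : ∀ K t, |t| ≤ l₀ → ∀ τ ∈ T K, shA K t τ ≤ ∑ s ∈ SA K, pieceA K t s τ)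
    (hwA : ∀ K t s, Measurable (wA K t s)) (hθA : ∀ j, 0 < θA j) (hκA : ∀ j, 0 < κA j ∧ κA j < 1) (hρA : ∀ j, 0 ≤ ρA j)
    (hMA : ∀ K t, |t| ≤ l₀ → ∀ s ∈ SA K, 0 ≤ MA K t s)
    (hpcA_int : ∀ K t, |t| ≤ l₀ → ∀ s ∈ SA K, ∀ τ ∈ T K,
      IntegrableOn (fun s' => pcA K t s s' τ) (Icc ((1 - κA (lvlA K s)) * θA (lvlA K s)) (θA (lvlA K s))))
    (hAsA_int : ∀ K t, |t| ≤ l₀ → ∀ s ∈ SA K, ∀ τ ∈ T K,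
      IntegrableOn (fun s' => AsA K t s s' τ) (Icc ((1 - κA (lvlA K s)) * θA (lvlA K s)) (θA (lvlA K s))))
    (hpushA : ∀ K t, |t| ≤ l₀ → ∀ s ∈ SA K, ∀ s' ∈ Icc ((1 - κA (lvlA K s)) * θA (lvlA K s)) (θA (lvlA K s)),
      ∑ τ ∈ T K, pcA K t s s' τ ≤ MA K t s * (νA K t s {x | s' * (1 - ρA (lvlA K s)) ≤ wA K t s x ∧ wA K t s x < s'}).toReal)
    (htotalA : ∀ K t, |t| ≤ l₀ → ∀ s ∈ SA K, ∀ s' ∈ Icc ((1 - κA (lvlA K s)) * θA (lvlA K s)) (θA (lvlA K s)),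
      MA K t s * (νA K t s univ).toReal ≤ ∑ τ ∈ T K, AsA K t s s' τ)
    (hpieceMixA : ∀ K t, |t| ≤ l₀ → ∀ s ∈ SA K, ∀ τ ∈ T K, pieceA K t s τ =
      (κA (lvlA K s) * θA (lvlA K s))⁻¹ * ∫ s' in Icc ((1 - κA (lvlA K s)) * θA (lvlA K s)) (θA (lvlA K s)), pcA K t s s' τ)
    (hAMixA : ∀ K t, |t| ≤ l₀ → ∀ s ∈ SA K, ∀ τ ∈ T K, A K t τ =
      (κA (lvlA K s) * θA (lvlA K s))⁻¹ * ∫ s' in Icc ((1 - κA (lvlA K s)) * θA (lvlA K s)) (θA (lvlA K s)), AsA K t s s' τ)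
    (sh_nonnegB : ∀ K t, |t| ≤ l₀ → ∀ τ ∈ T K, 0 ≤ shB K t τ)
    (sh_leB : ∀ K t, |t| ≤ l₀ → ∀ τ ∈ T K, shB K t τ ≤ B K t τ)
    (coverB : ∀ K t, |t| ≤ l₀ → ∀ τ ∈ T K, shB K t τ ≤ ∑ s ∈ SB K, pieceB K t s τ)
    (hwB : ∀ K t s, Measurable (wB K t s)) (hθB : ∀ j, 0 < θB j) (hκB : ∀ j, 0 < κB j ∧ κB j < 1) (hρB : ∀ j, 0 ≤ ρB j)
    (hMB : ∀ K t, |t| ≤ l₀ → ∀ s ∈ SB K, 0 ≤ MB K t s)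
    (hpcB_int : ∀ K t, |t| ≤ l₀ → ∀ s ∈ SB K, ∀ τ ∈ T K,
      IntegrableOn (fun s' => pcB K t s s' τ) (Icc ((1 - κB (lvlB K s)) * θB (lvlB K s)) (θB (lvlB K s))))
    (hAsB_int : ∀ K t, |t| ≤ l₀ → ∀ s ∈ SB K, ∀ τ ∈ T K,
      IntegrableOn (fun s' => AsB K t s s' τ) (Icc ((1 - κB (lvlB K s)) * θB (lvlB K s)) (θB (lvlB K s))))
    (hpushB : ∀ K t, |t| ≤ l₀ → ∀ s ∈ SB K, ∀ s' ∈ Icc ((1 - κB (lvlB K s)) * θB (lvlB K s)) (θB (lvlB K s)),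
      ∑ τ ∈ T K, pcB K t s s' τ ≤ MB K t s * (νB K t s {x | s' * (1 - ρB (lvlB K s)) ≤ wB K t s x ∧ wB K t s x < s'}).toReal)
    (htotalB : ∀ K t, |t| ≤ l₀ → ∀ s ∈ SB K, ∀ s' ∈ Icc ((1 - κB (lvlB K s)) * θB (lvlB K s)) (θB (lvlB K s)),
      MB K t s * (νB K t s univ).toReal ≤ ∑ τ ∈ T K, AsB K t s s' τ)
    (hpieceMixB : ∀ K t, |t| ≤ l₀ → ∀ s ∈ SB K, ∀ τ ∈ T K, pieceB K t s τ =
      (κB (lvlB K s) * θB (lvlB K s))⁻¹ * ∫ s' in Icc ((1 - κB (lvlB K s)) * θB (lvlB K s)) (θB (lvlB K s)), pcB K t s s' τ)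
    (hAMixB : ∀ K t, |t| ≤ l₀ → ∀ s ∈ SB K, ∀ τ ∈ T K, B K t τ =
      (κB (lvlB K s) * θB (lvlB K s))⁻¹ * ∫ s' in Icc ((1 - κB (lvlB K s)) * θB (lvlB K s)) (θB (lvlB K s)), AsB K t s s' τ)
    {N₁ : ℕ} {νbar κmin c₁ ϑ : ℝ} (hwinA : LiveWindow SA lvlA N₁ νbar) (hwinB : LiveWindow SB lvlB N₁ νbar)
    (hκmin : 0 < κmin) (hκminA : ∀ j, κmin ≤ κA j) (hκminB : ∀ j, κmin ≤ κB j)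
    (hϑ0 : 0 < ϑ) (hϑ1 : ϑ < 1) (hrateA : ∀ j, ρA j ≤ c₁ * ϑ ^ j) (hrateB : ∀ j, ρB j ≤ c₁ * ϑ ^ j)
    {Wsh : ℕ → ℝ} (hWsh : ∀ K, (2 * ((N₁ + 1) * νbar * (2 * κmin⁻¹) * c₁ * ϑ⁻¹ ^ N₁)) * ϑ ^ K ≤ Wsh K) (hsum : Summable Wsh) :
    ShellWeightBound l₀ T A B shA shB Wsh :=
  n21_knit_levels
    (levelLedger_of_thresholdMixture sh_nonnegA sh_leA coverA hwA hθA hκA hρA hMA hpcA_int hAsA_int hpushA htotalA hpieceMixA hAMixA)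
    (levelLedger_of_thresholdMixture sh_nonnegB sh_leB coverB hwB hθB hκB hρB hMB hpcB_int hAsB_int hpushB htotalB hpieceMixB hAMixB)
    hwinA hwinB (fun j => two_mul_inv_le hκmin (hκminA j)) (fun j => two_mul_inv_le hκmin (hκminB j)) hϑ0 hϑ1 hrateA hrateB
    hWsh hsum

end Explicit

/-! ## §3 The K5 stub at every sharp-push mixture reading -/

section AtCarriers

variable {N : ℕ} [NeZero N]

/-- **`S_N21` FOR EVERY SHARP-PUSH MIXTURE READING.**  If every bundle `S` the reading predicate `SRec` pins carries — for both runs — (R) (`sh ≥ 0`, `sh ≤` weight,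
cover by per-slot pieces), per slot a finite field law `ν K t s` with a measurable tested variable `w K t s`, thresholds `θ_j > 0`, admissible widths `0 < κ_j < 1`
bounded below by `κ_min > 0`, relative widths `0 ≤ ρ_j ≤ c₁ϑ^j` (N16), [dict] constants `M ≥ 0`, SHARP piece ∕ weight families integrable on each slot's window
with the two pushes at EVERY threshold of the window (NODE O), the carriers' pieces AND weights PINNED as the normalised window averages, live windows `(N₁, ν̄)` (N20)
and a summable record weight `S.Wsh ≥ 2((N₁+1)ν̄(2κ_min⁻¹)c₁ϑ^{−N₁})ϑ^K` — then `S_N21 SRec` (§2's `n21_knit_thresholdMixture` per pinned bundle).  NO (M1) binder.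
[folklore] -/
theorem s_N21_of_sharpPushMixtureReading (SRec : SpineRecordPred N)
    (hread : ∀ (F : T4Continuum.T4Family) (D : YMDAG.UVSplit.Datum F N) (g₀ : ℕ → ℝ)
      (os : List (T4Continuum.ULoop F)) (S : SpineCarriers), SRec F D g₀ os S →
      ∃ (σA σB : Type) (XA : ℕ → σA → Type) (XB : ℕ → σB → Type)
        (_mA : ∀ K s, MeasurableSpace (XA K s)) (_mB : ∀ K s, MeasurableSpace (XB K s))
        (νA : ∀ K : ℕ, ℝ → ∀ s : σA, Measure (XA K s)) (νB : ∀ K : ℕ, ℝ → ∀ s : σB, Measure (XB K s))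
        (_fA : ∀ K t s, IsFiniteMeasure (νA K t s)) (_fB : ∀ K t s, IsFiniteMeasure (νB K t s))
        (wA : ∀ K : ℕ, ℝ → ∀ s : σA, XA K s → ℝ) (wB : ∀ K : ℕ, ℝ → ∀ s : σB, XB K s → ℝ)
        (SA : ℕ → Finset σA) (SB : ℕ → Finset σB)
        (pieceA : ℕ → ℝ → σA → S.ι → ℝ) (pieceB : ℕ → ℝ → σB → S.ι → ℝ)
        (lvlA : ℕ → σA → ℕ) (lvlB : ℕ → σB → ℕ) (θA κA ρA θB κB ρB : ℕ → ℝ)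
        (MA : ℕ → ℝ → σA → ℝ) (MB : ℕ → ℝ → σB → ℝ)
        (pcA AsA : ∀ K : ℕ, ℝ → ∀ s : σA, ℝ → S.ι → ℝ) (pcB AsB : ∀ K : ℕ, ℝ → ∀ s : σB, ℝ → S.ι → ℝ)
        (N₁ : ℕ) (νbar κmin c₁ ϑ : ℝ),
        -- run A: (R), measurability, signs, integrability, SHARP pushes at every threshold of the window, carriers pinned as window averages
        (∀ K t, |t| ≤ S.l₀ → ∀ τ ∈ S.T K, 0 ≤ S.shA K t τ) ∧
        (∀ K t, |t| ≤ S.l₀ → ∀ τ ∈ S.T K, S.shA K t τ ≤ S.A K t τ) ∧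
        (∀ K t, |t| ≤ S.l₀ → ∀ τ ∈ S.T K, S.shA K t τ ≤ ∑ s ∈ SA K, pieceA K t s τ) ∧
        (∀ K t s, Measurable (wA K t s)) ∧ (∀ j, 0 < θA j) ∧ (∀ j, 0 < κA j ∧ κA j < 1) ∧ (∀ j, 0 ≤ ρA j) ∧
        (∀ K t, |t| ≤ S.l₀ → ∀ s ∈ SA K, 0 ≤ MA K t s) ∧
        (∀ K t, |t| ≤ S.l₀ → ∀ s ∈ SA K, ∀ τ ∈ S.T K,
          IntegrableOn (fun s' => pcA K t s s' τ) (Icc ((1 - κA (lvlA K s)) * θA (lvlA K s)) (θA (lvlA K s)))) ∧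
        (∀ K t, |t| ≤ S.l₀ → ∀ s ∈ SA K, ∀ τ ∈ S.T K,
          IntegrableOn (fun s' => AsA K t s s' τ) (Icc ((1 - κA (lvlA K s)) * θA (lvlA K s)) (θA (lvlA K s)))) ∧
        (∀ K t, |t| ≤ S.l₀ → ∀ s ∈ SA K, ∀ s' ∈ Icc ((1 - κA (lvlA K s)) * θA (lvlA K s)) (θA (lvlA K s)),
          ∑ τ ∈ S.T K, pcA K t s s' τ ≤ MA K t s * (νA K t s {x | s' * (1 - ρA (lvlA K s)) ≤ wA K t s x ∧ wA K t s x < s'}).toReal) ∧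
        (∀ K t, |t| ≤ S.l₀ → ∀ s ∈ SA K, ∀ s' ∈ Icc ((1 - κA (lvlA K s)) * θA (lvlA K s)) (θA (lvlA K s)),
          MA K t s * (νA K t s univ).toReal ≤ ∑ τ ∈ S.T K, AsA K t s s' τ) ∧
        (∀ K t, |t| ≤ S.l₀ → ∀ s ∈ SA K, ∀ τ ∈ S.T K, pieceA K t s τ =
          (κA (lvlA K s) * θA (lvlA K s))⁻¹ * ∫ s' in Icc ((1 - κA (lvlA K s)) * θA (lvlA K s)) (θA (lvlA K s)), pcA K t s s' τ) ∧
        (∀ K t, |t| ≤ S.l₀ → ∀ s ∈ SA K, ∀ τ ∈ S.T K, S.A K t τ =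
          (κA (lvlA K s) * θA (lvlA K s))⁻¹ * ∫ s' in Icc ((1 - κA (lvlA K s)) * θA (lvlA K s)) (θA (lvlA K s)), AsA K t s s' τ) ∧
        -- run B: the same
        (∀ K t, |t| ≤ S.l₀ → ∀ τ ∈ S.T K, 0 ≤ S.shB K t τ) ∧
        (∀ K t, |t| ≤ S.l₀ → ∀ τ ∈ S.T K, S.shB K t τ ≤ S.B K t τ) ∧
        (∀ K t, |t| ≤ S.l₀ → ∀ τ ∈ S.T K, S.shB K t τ ≤ ∑ s ∈ SB K, pieceB K t s τ) ∧
        (∀ K t s, Measurable (wB K t s)) ∧ (∀ j, 0 < θB j) ∧ (∀ j, 0 < κB j ∧ κB j < 1) ∧ (∀ j, 0 ≤ ρB j) ∧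
        (∀ K t, |t| ≤ S.l₀ → ∀ s ∈ SB K, 0 ≤ MB K t s) ∧
        (∀ K t, |t| ≤ S.l₀ → ∀ s ∈ SB K, ∀ τ ∈ S.T K,
          IntegrableOn (fun s' => pcB K t s s' τ) (Icc ((1 - κB (lvlB K s)) * θB (lvlB K s)) (θB (lvlB K s)))) ∧
        (∀ K t, |t| ≤ S.l₀ → ∀ s ∈ SB K, ∀ τ ∈ S.T K,
          IntegrableOn (fun s' => AsB K t s s' τ) (Icc ((1 - κB (lvlB K s)) * θB (lvlB K s)) (θB (lvlB K s)))) ∧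
        (∀ K t, |t| ≤ S.l₀ → ∀ s ∈ SB K, ∀ s' ∈ Icc ((1 - κB (lvlB K s)) * θB (lvlB K s)) (θB (lvlB K s)),
          ∑ τ ∈ S.T K, pcB K t s s' τ ≤ MB K t s * (νB K t s {x | s' * (1 - ρB (lvlB K s)) ≤ wB K t s x ∧ wB K t s x < s'}).toReal) ∧
        (∀ K t, |t| ≤ S.l₀ → ∀ s ∈ SB K, ∀ s' ∈ Icc ((1 - κB (lvlB K s)) * θB (lvlB K s)) (θB (lvlB K s)),
          MB K t s * (νB K t s univ).toReal ≤ ∑ τ ∈ S.T K, AsB K t s s' τ) ∧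
        (∀ K t, |t| ≤ S.l₀ → ∀ s ∈ SB K, ∀ τ ∈ S.T K, pieceB K t s τ =
          (κB (lvlB K s) * θB (lvlB K s))⁻¹ * ∫ s' in Icc ((1 - κB (lvlB K s)) * θB (lvlB K s)) (θB (lvlB K s)), pcB K t s s' τ) ∧
        (∀ K t, |t| ≤ S.l₀ → ∀ s ∈ SB K, ∀ τ ∈ S.T K, S.B K t τ =
          (κB (lvlB K s) * θB (lvlB K s))⁻¹ * ∫ s' in Icc ((1 - κB (lvlB K s)) * θB (lvlB K s)) (θB (lvlB K s)), AsB K t s s' τ) ∧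
        -- windows (N20), admissible widths, rate (N16), record weight
        LiveWindow SA lvlA N₁ νbar ∧ LiveWindow SB lvlB N₁ νbar ∧ 0 < κmin ∧ (∀ j, κmin ≤ κA j) ∧ (∀ j, κmin ≤ κB j) ∧
        0 < ϑ ∧ ϑ < 1 ∧ (∀ j, ρA j ≤ c₁ * ϑ ^ j) ∧ (∀ j, ρB j ≤ c₁ * ϑ ^ j) ∧
        (∀ K, (2 * ((N₁ + 1) * νbar * (2 * κmin⁻¹) * c₁ * ϑ⁻¹ ^ N₁)) * ϑ ^ K ≤ S.Wsh K) ∧ Summable S.Wsh) :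
    S_N21 SRec := by
  intro F D g₀ os S hS
  obtain ⟨σA, σB, XA, XB, mA, mB, νA, νB, fA, fB, wA, wB, SA, SB, pieceA, pieceB, lvlA, lvlB, θA, κA, ρA, θB, κB, ρB, MA, MB,
    pcA, AsA, pcB, AsB, N₁, νbar, κmin, c₁, ϑ, sh_nonnegA, sh_leA, coverA, hwA, hθA, hκA, hρA, hMA, hpcA, hAsA, hpushA, htotalA, hpieceMixA,
    hAMixA, sh_nonnegB, sh_leB, coverB, hwB, hθB, hκB, hρB, hMB, hpcB, hAsB, hpushB, htotalB, hpieceMixB, hAMixB, hwinA, hwinB, hκmin,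
    hκminA, hκminB, hϑ0, hϑ1, hrA, hrB, hWsh, hsum⟩ := hread F D g₀ os S hS
  exact n21_knit_thresholdMixture sh_nonnegA sh_leA coverA hwA hθA hκA hρA hMA hpcA hAsA hpushA htotalA hpieceMixA hAMixA sh_nonnegB sh_leB
    coverB hwB hθB hκB hρB hMB hpcB hAsB hpushB htotalB hpieceMixB hAMixB hwinA hwinB hκmin hκminA hκminB hϑ0 hϑ1 hrA hrB hWsh hsum

end AtCarriers

end Summit.QuantumFields.YangMills.Theorems.N21LevelLedgerMixture

end
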